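import Mathlib
import HarnessLib
import Literature.MathematicalPhysics.QuantumLattice.GaugeGroups
import Literature.LinearAlgebra.Matrix.UnitaryGroupConjugacyClasses
import Summits.Ventures.LatticeQCDFlow.Exactness.KernelJacobianChart
import Summits.Ventures.LatticeQCDFlow.Exactness.SpectralCouplingMeasurable

/-!
# The spectral kernel's Jacobian for Haar on `U(n)`, given the Weyl presentation of Haar by conjugation of the diagonal torus: `J(g t g⁻¹)·|Δ(t)|² = J_f(t)·|Δ(f t)|²`

HONEST FRAMING: exact (Metropolis-corrected) sampling algorithms for lattice gauge theory;
figures of merit are autocorrelation/cost numbers at stated couplings and volumes; no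
continuum-physics claim.

Venture `LatticeQCDFlow` (cell pub-lqcd), topic `Exactness`; FANOUT row 10 (`eng-equiv`, engine
`latflow.equiv`, `spectral.py` / `flows_jax.spectral_jax`: the log-det booked for the `SU(N)` /
`U(N)` spectral kernel = log-det of the eigenvalue map + `log |Δ(f λ)|² − log |Δ(λ)|²`).  NEW
WORK of the cell over `KernelJacobianChart.lean` (Jacobian through a measure-presenting chart),
`SpectralKernelContinuity.lean` / `SpectralCouplingMeasurable.lean` (the kernel is continuous,
hence Borel measurable; `U(n)` second countable) and the tree's
`Literature/LinearAlgebra/Matrix/UnitaryGroup{MaximalTorus,ConjugacyClasses}.lean` (the diagonal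
torus `Δ(n)`, compact); nothing is cited as a fact; no number; no definition is introduced.
Printed counterparts, NAMED ONLY: Boyda et al., PRD 103 (2021) 074504, eq. (19); H. Weyl's
integral formula, Bröcker–tom Dieck, *Representations of Compact Lie Groups*, IV (1.11), p. 163
(`|W| ∫_G f = ∫_T det(E − Ad_{G/T}(t⁻¹)) ∫_G f(g t g⁻¹) dg dt`; for `U(n)`: `|W| = n!` and the
determinant is `∏_{μ≠ν} |t_μ − t_ν| = |Δ(t)|²` by the root computation V (6.2)) — it enters
below as the HYPOTHESIS `hW` (a pushforward identity), not as an assertion: the tree does not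
hold the Weyl formula (cf. the NOT-asserted remarks in `Literature/Barriers/QuantumFields/
UnitaryHaarSmallBall.lean`, `EguchiKawaiBreakdownProofs.lean`).

## What is typed (`n` a finite index type; `T = Δ(n)` the diagonal torus of `U(n)`, as a compact group with its own Haar probability)

* `coe_diagonalTorus_eq_diagonal` — `t ∈ Δ(n)` is `diag(t_ii)`; `measurable_conjChart` — the
  chart `(g, t) ↦ g t g⁻¹ : U(n) × Δ(n) → U(n)` is measurable; `measurable_vandermondeWeight` —
  `t ↦ |Δ(t)|²/n! = (∏_i ∏_{j≠i} |t_ii − t_jj|)/n!` is measurable on `Δ(n)`;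
* **`spectralKernel_conj_diagonalTorus`** — THE INTERTWINING: a kernel `h` following the
  spectral recipe of `f` and a torus map `f_T` with `f_T(diag d) = diag(f d)` satisfy
  `h (g t g⁻¹) = g · f_T t · g⁻¹`;
* **`hasJacobian_spectralKernel_unitaryGroup_of_presentation`** — for ANY measurable weight `D`
  on `Δ(n)` such that conjugation presents Haar, `(g,t) ↦ g t g⁻¹` pushing
  `Haar_{U(n)} ⊗ D·Haar_{Δ(n)}` to `Haar_{U(n)}` (hypothesis `hW`): if `f` is continuous on the
  unimodular torus, `f_T` has Jacobian `J_f` for `Haar_{Δ(n)}`, and the measurable candidate `J`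
  satisfies `J(g t g⁻¹) · D t = J_f t · D (f_T t)`, then `HasJacobian (Haar U(n)) h J`;
* **`hasJacobian_spectralKernel_unitaryGroup_of_weyl`** — the same with `D = |Δ|²/n!` written
  out: `hW` is then LITERALLY Weyl's integral formula for `U(n)` in pushforward form, and the
  identity for `J` is Boyda's eq. (19), `J = J_f · |Δ ∘ f|² / |Δ|²`, cleared of denominators.

With `SpectralCouplingMeasurable.hasJacobian_spectralCouplingLayer_of_kernelJacobian_unitary`
this closes the `U(n)` spectral coupling layer's exactness modulo exactly: Weyl's formula
(`hW`) and the eigenvalue map's torus Jacobian (`J_f`).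

NOT here: Weyl's integral formula (hypothesis); the `SU(n)` twin (same shape with `SΔ(n)`,
`|W| = n!`); that `|Δ(t)| ≠ 0` Haar-a.e.; any number.
-/

noncomputable section

namespace Summit.Ventures.LatticeQCDFlow.Exactness

open MeasureTheory Matrix Topology
open Literature.LinearAlgebra.Matrix
open Literature.MathematicalPhysics.QuantumFieldTheory
open scoped ENNReal

variable {n : Type*} [Fintype n] [DecidableEq n]

/-! ## The diagonal torus and the conjugation chart -/

/-- An element of `Δ(n)` is the diagonal matrix of its diagonal entries. -/
theorem coe_diagonalTorus_eq_diagonal (t : diagonalTorus n) :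
    ((t : Matrix.unitaryGroup n ℂ) : Matrix n n ℂ) =
      diagonal fun i => ((t : Matrix.unitaryGroup n ℂ) : Matrix n n ℂ) i i := by
  obtain ⟨d, hd⟩ := t.2
  rw [hd]
  ext i j
  by_cases hij : i = j
  · subst hij
    rw [diagonal_apply_eq, diagonal_apply_eq, diagonal_apply_eq]
  · rw [diagonal_apply_ne _ hij, diagonal_apply_ne _ hij]

/-- The diagonal entries of `t ∈ Δ(n)` are unimodular. -/
theorem norm_diagonalTorus_apply (t : diagonalTorus n) (i : n) :
    ‖((t : Matrix.unitaryGroup n ℂ) : Matrix n n ℂ) i i‖ = 1 :=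
  norm_eq_one_of_mem_diagonalTorus (coe_diagonalTorus_eq_diagonal t) i

/-- `Δ(n)` is second countable (a subspace of `U(n)`). -/
theorem secondCountableTopology_diagonalTorus : SecondCountableTopology (diagonalTorus n) :=
  haveI : SecondCountableTopology (Matrix.unitaryGroup n ℂ) := secondCountableTopology_unitaryGroup n
  Topology.IsEmbedding.subtypeVal.secondCountableTopology

/-- **The conjugation chart `(g, t) ↦ g t g⁻¹ : U(n) × Δ(n) → U(n)` is continuous.** -/
theorem continuous_conjChart :
    Continuous fun q : Matrix.unitaryGroup n ℂ × diagonalTorus n =>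
      q.1 * (q.2 : Matrix.unitaryGroup n ℂ) * q.1⁻¹ :=
  (continuous_fst.mul (continuous_subtype_val.comp continuous_snd)).mul continuous_fst.inv

/-- **… hence measurable** (Borel structures; both factors second countable). -/
theorem measurable_conjChart :
    Measurable fun q : Matrix.unitaryGroup n ℂ × diagonalTorus n =>
      q.1 * (q.2 : Matrix.unitaryGroup n ℂ) * q.1⁻¹ :=
  haveI : SecondCountableTopology (Matrix.unitaryGroup n ℂ) := secondCountableTopology_unitaryGroup n
  haveI : SecondCountableTopology (diagonalTorus n) := secondCountableTopology_diagonalTorus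
  continuous_conjChart.measurable

/-- **The Vandermonde weight `t ↦ |Δ(t)|²/n! = (∏_i ∏_{j ≠ i} |t_ii − t_jj|)/n!` is measurable on
`Δ(n)`** (continuous). -/
theorem measurable_vandermondeWeight :
    Measurable fun t : diagonalTorus n => ENNReal.ofReal
      ((∏ i, ∏ j ∈ Finset.univ.erase i,
        ‖((t : Matrix.unitaryGroup n ℂ) : Matrix n n ℂ) i i -
          ((t : Matrix.unitaryGroup n ℂ) : Matrix n n ℂ) j j‖) / (Fintype.card n).factorial) := by
  have hentry : ∀ i : n, Continuous fun t : diagonalTorus n =>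
      ((t : Matrix.unitaryGroup n ℂ) : Matrix n n ℂ) i i := fun i =>
    ((continuous_apply i).comp ((continuous_apply i).comp
      (continuous_subtype_val.comp continuous_subtype_val)))
  refine (ENNReal.continuous_ofReal.comp ?_).measurable
  exact (continuous_finsetProd _ fun i _ => continuous_finsetProd _ fun j _ =>
    ((hentry i).sub (hentry j)).norm).div_const _

/-! ## The intertwining: the kernel conjugates the torus map -/

/-- **The spectral kernel intertwines conjugation with its torus map**: if `h : U(n) → U(n)`
follows the spectral recipe of `f` and `f_T : Δ(n) → Δ(n)` is `diag(d) ↦ diag(f d)`, then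
`h (g t g⁻¹) = g · f_T t · g⁻¹` for all `g ∈ U(n)`, `t ∈ Δ(n)`. -/
theorem spectralKernel_conj_diagonalTorus {f : (n → ℂ) → (n → ℂ)}
    {h : Matrix.unitaryGroup n ℂ → Matrix.unitaryGroup n ℂ}
    (hagree : ∀ (P : Matrix.unitaryGroup n ℂ) (V : Matrix n n ℂ) (d : n → ℂ),
      V ∈ Matrix.unitaryGroup n ℂ → (P : Matrix n n ℂ) = V * diagonal d * star V →
        ((h P : Matrix.unitaryGroup n ℂ) : Matrix n n ℂ) = V * diagonal (f d) * star V)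
    {fT : diagonalTorus n → diagonalTorus n}
    (hfT : ∀ t : diagonalTorus n, ((fT t : Matrix.unitaryGroup n ℂ) : Matrix n n ℂ) =
      diagonal (f fun i => ((t : Matrix.unitaryGroup n ℂ) : Matrix n n ℂ) i i))
    (g : Matrix.unitaryGroup n ℂ) (t : diagonalTorus n) :
    h (g * (t : Matrix.unitaryGroup n ℂ) * g⁻¹) = g * (fT t : Matrix.unitaryGroup n ℂ) * g⁻¹ := by
  apply Subtype.ext
  have hP : ((g * (t : Matrix.unitaryGroup n ℂ) * g⁻¹ : Matrix.unitaryGroup n ℂ) : Matrix n n ℂ) =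
      (g : Matrix n n ℂ) * diagonal (fun i => ((t : Matrix.unitaryGroup n ℂ) : Matrix n n ℂ) i i) *
        star (g : Matrix n n ℂ) := by
    rw [Matrix.UnitaryGroup.mul_val, Matrix.UnitaryGroup.mul_val, Matrix.UnitaryGroup.inv_val,
      ← coe_diagonalTorus_eq_diagonal t]
  rw [hagree _ _ _ g.2 hP, Matrix.UnitaryGroup.mul_val, Matrix.UnitaryGroup.mul_val,
    Matrix.UnitaryGroup.inv_val, hfT t]

/-! ## The Jacobian, given a presentation of Haar by conjugation -/

/-- **The spectral kernel's Jacobian for Haar on `U(n)`, given ANY conjugation presentation.**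
Let `D` be a measurable weight on `Δ(n)` such that `(g, t) ↦ g t g⁻¹` pushes
`Haar_{U(n)} ⊗ D·Haar_{Δ(n)}` forward to `Haar_{U(n)}` (`hW`).  Let `f` be continuous on the
unimodular torus, `h` follow its spectral recipe, `f_T` be its torus map with Jacobian `J_f` for
`Haar_{Δ(n)}`, and `J` be measurable with `J(g t g⁻¹) · D t = J_f t · D (f_T t)`.  Then
`HasJacobian (Haar U(n)) h J`. -/
theorem hasJacobian_spectralKernel_unitaryGroup_of_presentation
    {D : diagonalTorus n → ℝ≥0∞} (hD : Measurable D)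
    (hW : Measure.map (fun q : Matrix.unitaryGroup n ℂ × diagonalTorus n =>
        q.1 * (q.2 : Matrix.unitaryGroup n ℂ) * q.1⁻¹)
      ((haarProbability (Matrix.unitaryGroup n ℂ)).prod
        ((haarProbability (diagonalTorus n)).withDensity D)) =
      haarProbability (Matrix.unitaryGroup n ℂ))
    {f : (n → ℂ) → (n → ℂ)} (hfc : ContinuousOn f {d | ∀ i, ‖d i‖ = 1})
    {h : Matrix.unitaryGroup n ℂ → Matrix.unitaryGroup n ℂ}
    (hagree : ∀ (P : Matrix.unitaryGroup n ℂ) (V : Matrix n n ℂ) (d : n → ℂ),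
      V ∈ Matrix.unitaryGroup n ℂ → (P : Matrix n n ℂ) = V * diagonal d * star V →
        ((h P : Matrix.unitaryGroup n ℂ) : Matrix n n ℂ) = V * diagonal (f d) * star V)
    {fT : diagonalTorus n → diagonalTorus n}
    (hfT : ∀ t : diagonalTorus n, ((fT t : Matrix.unitaryGroup n ℂ) : Matrix n n ℂ) =
      diagonal (f fun i => ((t : Matrix.unitaryGroup n ℂ) : Matrix n n ℂ) i i))
    {Jf : diagonalTorus n → ℝ≥0∞} (hfJ : HasJacobian (haarProbability (diagonalTorus n)) fT Jf)
    {J : Matrix.unitaryGroup n ℂ → ℝ≥0∞} (hJm : Measurable J)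
    (hJ : ∀ (g : Matrix.unitaryGroup n ℂ) (t : diagonalTorus n),
      J (g * (t : Matrix.unitaryGroup n ℂ) * g⁻¹) * D t = Jf t * D (fT t)) :
    HasJacobian (haarProbability (Matrix.unitaryGroup n ℂ)) h J :=
  hasJacobian_of_chart measurable_conjChart hD hW hfJ (measurable_spectralKernel_unitaryGroup hfc hagree)
    (fun g t => spectralKernel_conj_diagonalTorus hagree hfT g t) hJm (fun q => hJ q)

/-- **The spectral kernel's Jacobian for Haar on `U(n)`, given Weyl's integral formula.**  With
the Vandermonde weight `D(t) = |Δ(t)|²/n! = (∏_i ∏_{j≠i} |t_ii − t_jj|)/n!` the presentation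
hypothesis `hW` reads: conjugation pushes `Haar_{U(n)} ⊗ (|Δ|²/n!)·Haar_{Δ(n)}` forward to
`Haar_{U(n)}` — Weyl's integral formula for `U(n)` (Bröcker–tom Dieck IV (1.11) with `|W| = n!`
and `det(E − Ad(t⁻¹)) = |Δ(t)|²`), in pushforward form, ASSUMED; and the identity for `J` is
Boyda's eq. (19): `J(g t g⁻¹) · |Δ(t)|² = J_f(t) · |Δ(f_T t)|²`.  Conclusion:
`HasJacobian (Haar U(n)) h J` — the kernel with the engine's booked density is an exact transport
of Haar. -/
theorem hasJacobian_spectralKernel_unitaryGroup_of_weyl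
    (hW : Measure.map (fun q : Matrix.unitaryGroup n ℂ × diagonalTorus n =>
        q.1 * (q.2 : Matrix.unitaryGroup n ℂ) * q.1⁻¹)
      ((haarProbability (Matrix.unitaryGroup n ℂ)).prod
        ((haarProbability (diagonalTorus n)).withDensity fun t => ENNReal.ofReal
          ((∏ i, ∏ j ∈ Finset.univ.erase i,
            ‖((t : Matrix.unitaryGroup n ℂ) : Matrix n n ℂ) i i -
              ((t : Matrix.unitaryGroup n ℂ) : Matrix n n ℂ) j j‖) / (Fintype.card n).factorial))) =
      haarProbability (Matrix.unitaryGroup n ℂ))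
    {f : (n → ℂ) → (n → ℂ)} (hfc : ContinuousOn f {d | ∀ i, ‖d i‖ = 1})
    {h : Matrix.unitaryGroup n ℂ → Matrix.unitaryGroup n ℂ}
    (hagree : ∀ (P : Matrix.unitaryGroup n ℂ) (V : Matrix n n ℂ) (d : n → ℂ),
      V ∈ Matrix.unitaryGroup n ℂ → (P : Matrix n n ℂ) = V * diagonal d * star V →
        ((h P : Matrix.unitaryGroup n ℂ) : Matrix n n ℂ) = V * diagonal (f d) * star V)
    {fT : diagonalTorus n → diagonalTorus n}
    (hfT : ∀ t : diagonalTorus n, ((fT t : Matrix.unitaryGroup n ℂ) : Matrix n n ℂ) =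
      diagonal (f fun i => ((t : Matrix.unitaryGroup n ℂ) : Matrix n n ℂ) i i))
    {Jf : diagonalTorus n → ℝ≥0∞} (hfJ : HasJacobian (haarProbability (diagonalTorus n)) fT Jf)
    {J : Matrix.unitaryGroup n ℂ → ℝ≥0∞} (hJm : Measurable J)
    (hJ : ∀ (g : Matrix.unitaryGroup n ℂ) (t : diagonalTorus n),
      J (g * (t : Matrix.unitaryGroup n ℂ) * g⁻¹) * ENNReal.ofReal
          ((∏ i, ∏ j ∈ Finset.univ.erase i,
            ‖((t : Matrix.unitaryGroup n ℂ) : Matrix n n ℂ) i i -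
              ((t : Matrix.unitaryGroup n ℂ) : Matrix n n ℂ) j j‖) / (Fintype.card n).factorial) =
        Jf t * ENNReal.ofReal
          ((∏ i, ∏ j ∈ Finset.univ.erase i,
            ‖((fT t : Matrix.unitaryGroup n ℂ) : Matrix n n ℂ) i i -
              ((fT t : Matrix.unitaryGroup n ℂ) : Matrix n n ℂ) j j‖) / (Fintype.card n).factorial)) :
    HasJacobian (haarProbability (Matrix.unitaryGroup n ℂ)) h J :=
  hasJacobian_spectralKernel_unitaryGroup_of_presentation measurable_vandermondeWeight hW hfc hagree
    hfT hfJ hJm hJ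

end Summit.Ventures.LatticeQCDFlow.Exactness
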